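import Summits.BirchSwinnertonDyer.BirchSwinnertonDyer.Theorems.GenusKolyvaginAtTwoPowDvdShaCardAtTwoRTRelaxedRung
import HarnessLib

/-!
# Route `GenusKolyvaginAtTwo`, LINE 18 `plus_descent` on L_T `PowDvdShaCardAtTwoRT` (stmt-BirchSwinnertonDyer-23242), stub 3a⁗ —
# TOOLBOX: the K-SIDE ENTRY POINT of the one-bit rung (a `τ`-invariant Selmer class over `K`, Kolyvagin's currency), and the
# sign-free one-bit descent (for LINE 19)

Seat `bsd-line-gk2-p1` g14 (LEAD seat 1/3, cell `bsd-f1-sign2`), `--supports stmt-BirchSwinnertonDyer-23242 --as helper`; sequel of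
`…RTRelaxedRung` (§5 one-bit rung, §6 finite index / binder-light forms), split off for the 400-line cap.
THEOREMS ONLY (no definition, no named fact, no `sorry`).  Nothing here closes an item; BSD is not proved by any of this.

Kolyvagin's odd-depth classes live in `Sel^{(2^M)}(E_K/K)` and are `τ`-INVARIANT for the rank-zero member (gk2-p3
`KolyvaginClassSign.sign_conjAct_kolyvaginClass_two`: sign `−w(E)·(−1)^{#primes} = +1` for `w(E) = +1` and odd depth); gk2-p3's unique
descent (`EigenClassesFinite.existsUnique_resTorsion_eq_of_conjAct_eq`, any non-trivial `τ` via `eq_sigmaQ_of_ne_one`) and the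
injectivity of `res` (`E(K)[2^M] = 0` from `ρ̄_{E,2}` onto) turn such a class into the input of the one-bit rung:

* `two_mul_sub_one_le_padicValNat_sha_of_invariant_selmer_class` — **`Δ<0`, `ρ̄_{E,2}` onto, `rank E(ℚ)=0`, `K` imaginary quadratic,
  `τ ≠ 1`, `y ∈ Sel^{(2^M)}(E_K/K)`, `τ·y = y`, `ord y = 2^a` ⟹ `2(a−1) ≤ ord₂ #Ш(E/ℚ)[2^∞]`** (feed `y = c_{M₀}(ℓ)`: at prime primitive level
  `a = M₀`, giving `2M₀ − 2 ≤ ord₂ g`, cf. the lead memo `Cruxes/PowDvdShaCardAtTwoRT/Lines/plus-descent-lead-g14.md`);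
* `two_zsmul_mem_selmerGroup_of_resTorsion_mem_of_infinite` — the one-bit descent with the real places carried as a hypothesis
  (no sign condition on `Δ`; LINE 19).

References: [GrossLMS1991] §5 (5.1), Prop. 5.4; [McCallumLMS1991] §4 Lemma 4.3, §5 p. 310; [Kolyvagin1989Izv] §3.
-/

noncomputable section

-- `Summit.<P>.<Sub>` repeats `BirchSwinnertonDyer` by the tree's layout convention (D-0017)
set_option linter.dupNamespace false

open scoped Classical

namespace Summit.BirchSwinnertonDyer.BirchSwinnertonDyer.Theorems.GenusExact.PlusDescent

open _root_.WeierstrassCurve AddSubgroup NumberField Literature.NumberTheory.EllipticCurves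

variable (W : WeierstrassCurve ℚ) [W.IsElliptic] {K : Type} [Field K] [NumberField K]

/-- **K-SIDE ENTRY POINT of the one-bit rung.**  `W/ℚ` elliptic with `Δ < 0`, `ρ̄_{E,2}` onto, `rank E(ℚ) = 0`, `Ш(E/ℚ)[2^∞]` finite;
`K` imaginary quadratic, `τ ∈ Aut(K/ℚ)` non-trivial; `y ∈ Sel^{(2^M)}(E_K/K)` with `τ·y = y` (`conjAct`) and `ord y = 2^a`.  Then
**`2(a−1) ≤ ord₂ #Ш(E/ℚ)[2^∞]`**: `y = res c` for a unique `c ∈ H¹(ℚ, E[2^M])` (`E(K)[2^M] = 0`), `ord c = ord y` (`res` injective),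
and the one-bit rung `two_mul_sub_one_le_padicValNat_sha_of_resTorsion_mem_selmerGroup'` applies.
[cite: GrossLMS1991, §5 (5.1) and Prop. 5.4] [cite: McCallumLMS1991, §5 p. 310] -/
theorem two_mul_sub_one_le_padicValNat_sha_of_invariant_selmer_class (hK : IsImaginaryQuadratic K) (hΔ : W.Δ < 0)
    (hρ : W.HasSurjectiveModNGaloisRep 2) (hrk : W.mordellWeilRank = 0) [Finite (AddCommGroup.primaryComponent W.sha 2)]
    (τ : K ≃ₐ[ℚ] K) (hτ : τ ≠ 1) (M : ℕ) {y : galH1Torsion (W.baseChange K) ((2 ^ M : ℕ) : ℤ)}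
    (hy : y ∈ selmerGroup (W.baseChange K) ((2 ^ M : ℕ) : ℤ)) (hτy : conjAct W τ ((2 ^ M : ℕ) : ℤ) y = y)
    {a : ℕ} (hya : addOrderOf y = 2 ^ a) :
    2 * (a - 1) ≤ padicValNat 2 (Nat.card (AddCommGroup.primaryComponent W.sha 2)) := by
  obtain ⟨θ, hθ, hθsq⟩ :=
    Literature.NumberTheory.QuadraticFields.Quadratic.exists_not_mem_range_sq_eq_discr (K := K) hK.1
  have hL : ∀ P : (W.baseChange K).toAffine.Point, ((2 ^ M : ℕ) : ℤ) • P = 0 → P = 0 :=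
    forall_two_pow_zsmul_eq_zero_imp W
      (forall_two_nsmul_baseChange_of_hasSurjectiveModNGaloisRep_two_of_isImaginaryQuadratic W hρ K hK) M
  have hστ : τ = sigmaQ K hK.1 hθ hθsq := eq_sigmaQ_of_ne_one K hK.1 τ hτ hθ hθsq
  rw [hστ] at hτy
  obtain ⟨c, hc, -⟩ :=
    GenusExact.EigenClassesFinite.existsUnique_resTorsion_eq_of_conjAct_eq W K hK.1 hθ hθsq _ hL hτy
  have hinj := GenusExact.EigenClassesFinite.resTorsion_injective_of_noTorsion W K hK.1 hθ hθsq ((2 ^ M : ℕ) : ℤ) hL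
  have hca : addOrderOf c = 2 ^ a := by
    rw [← addOrderOf_injective _ hinj c, hc, hya]
  exact two_mul_sub_one_le_padicValNat_sha_of_resTorsion_mem_selmerGroup' W hK hΔ hρ hrk M (by rw [hc]; exact hy) hca

/-- **The same in divisibility form**: `2^{2(a−1)} ∣ #Ш(E/ℚ)[2^∞]`. [cite: McCallumLMS1991, §5 p. 310] -/
theorem pow_dvd_natCard_sha_of_invariant_selmer_class (hK : IsImaginaryQuadratic K) (hΔ : W.Δ < 0)
    (hρ : W.HasSurjectiveModNGaloisRep 2) (hrk : W.mordellWeilRank = 0) [Finite (AddCommGroup.primaryComponent W.sha 2)]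
    (τ : K ≃ₐ[ℚ] K) (hτ : τ ≠ 1) (M : ℕ) {y : galH1Torsion (W.baseChange K) ((2 ^ M : ℕ) : ℤ)}
    (hy : y ∈ selmerGroup (W.baseChange K) ((2 ^ M : ℕ) : ℤ)) (hτy : conjAct W τ ((2 ^ M : ℕ) : ℤ) y = y)
    {a : ℕ} (hya : addOrderOf y = 2 ^ a) :
    2 ^ (2 * (a - 1)) ∣ Nat.card (AddCommGroup.primaryComponent W.sha 2) := by
  haveI : Fact (Nat.Prime 2) := ⟨Nat.prime_two⟩
  rw [padicValNat_dvd_iff_le (Nat.card_pos (α := AddCommGroup.primaryComponent W.sha 2)).ne']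
  exact two_mul_sub_one_le_padicValNat_sha_of_invariant_selmer_class W hK hΔ hρ hrk τ hτ M hy hτy hya

omit [W.IsElliptic] in
/-- **Sign-free one-bit descent** (for LINE 19, `Δ > 0`, where the real places carry a condition): `[K : ℚ] = 2`, `res u ∈ Sel^{(n)}(E_K/K)`
and `u` satisfies the local condition at every infinite place of `ℚ` ⟹ `2u ∈ Sel^{(n)}(E/ℚ)` (finite places: gk2-p3's
`SelmerDescent.two_zsmul_mem_selmerLocalKer_of_K`). [cite: McCallumLMS1991, §4 Lemma 4.3] [cite: Kolyvagin1989Izv, §3] -/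
theorem two_zsmul_mem_selmerGroup_of_resTorsion_mem_of_infinite (h2 : Module.finrank ℚ K = 2) (n : ℤ)
    {u : galH1Torsion W n} (hu : resTorsion W K n u ∈ selmerGroup (W.baseChange K) n)
    (hinf : ∀ w : InfinitePlace ℚ, u ∈ selmerLocalKer W w.Completion n) :
    (2 : ℤ) • u ∈ selmerGroup W n := by
  rw [mem_selmerGroup_iff] at hu ⊢
  exact ⟨fun v ↦ GenusExact.SelmerDescent.two_zsmul_mem_selmerLocalKer_of_K W h2 n rfl v (fun w _ ↦ hu.1 w),
    fun w ↦ AddSubgroup.zsmul_mem _ (hinf w) 2⟩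

end Summit.BirchSwinnertonDyer.BirchSwinnertonDyer.Theorems.GenusExact.PlusDescent

end
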